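import Summits.QuantumFields.QCD.Theses.QuarksAsStableAction
import Summits.QuantumFields.QCD.Theorems.QuarksAsStableActionUnquenchedChessboardBound
import Summits.QuantumFields.QCD.Theorems.QuarksAsStableActionWilsonQuarkStability
import Summits.QuantumFields.QCD.Theorems.QuarksAsStableActionStableActionBridgeSoftClosureTensor
import Summits.QuantumFields.QCD.Theorems.QuarksAsStableActionStableActionBridgeStubAbstractThermalRP
import Summits.QuantumFields.QCD.Theorems.QuarksAsStableActionStableActionBridgeStubInsertionLocal
import Summits.QuantumFields.QCD.Theorems.QuarksAsStableActionStableActionBridgeStubMesonReflect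
import Summits.QuantumFields.QCD.Theorems.QuarksAsStableActionStableActionBridgeSoftClosureAsymptotic
import Summits.QuantumFields.QCD.Theorems.QuarksAsStableActionStableActionBridgeStubPermExactSymAP
import Summits.QuantumFields.QCD.Theorems.QuarksAsStableActionStableActionBridgeStubRpOfSymThermal
import Literature.MathematicalPhysics.QuantumFieldTheory.MassGapFromLatticeClustering
import Literature.MathematicalPhysics.QuantumFieldTheory.QCDAsymptoticScalingCouplingDivergence
import HarnessLib
import Summits.QuantumFields.QCD.Statement

/-!
# Line `Sketch` for crux `QuarksAsStableAction.StableActionBridge` (item stmt-QuantumFields-9737,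
# route route-QuantumFields-QuarksAsStableAction) — lead skeleton, RESHAPE r3e (continuation lead c16, cycle 17, 2026-08-17)

`StableActionBridge := UnquenchedChessboardBound → WilsonQuarkStability → QCD`; both hypotheses are theorems of the tree
(A = item 9735, S = item 9736), so the crux is LITERALLY the conjunct `QCD = QCDOf 2 ∧ QCDOf 3` (`stableActionBridge_iff_qcd`).
The line cuts it along the LATTICE / CONTINUUM seam of the Osterwalder–Schrader framework (r3, c15) and keeps shrinking what the
lattice side must deliver by PROVING lattice theorems (r3c T0; r3d exact E3 + `⁰𝒮`-totality of real tensors; r3e THIS FILE).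

## r3e: the package is read on the THERMAL, Θ-SYMMETRISED functional — OS positivity is no longer a hypothesis

r3d's package still ASSUMED clause P8 (eventually approximately positive OS forms of the statement's time-PERIODIC torus
functional).  Two facts stand in the way of proving it at finite `k`: the periodic quark boundary condition computes the
`(−1)^F`-twisted trace, and the statement's `glue` representative is the FORWARD Wilson action density, which the site
reflection `Θ` maps to the BACKWARD density (`insertion (Θ'U) glue (θy) = S(y) + T(y − ê₀)`), so the smeared OS forms of the
statement's functional are not squares.  r3e therefore reads the package on the functional that IS reflection positive at
finite `k`:
* thermal boundary condition (`qcdTorusExpectAP`, antiperiodic quarks = the honest trace of Lüscher's transfer matrix), for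
  which the tree PROVES site-reflection positivity (`WilsonQCDSiteReflectionPositivityAP_holds`) and, landed in wave 2 of this
  cycle, for ARBITRARY positive-time coefficient-regular torus functions (`stub_abstractThermalRP`, p143920);
* Θ-SYMMETRISED insertions `insertionSym U s y = ½ (insertion U s y + Θ (insertion (Θ'U) s (θy)))` (time-clover density
  for `glue`; the meson itself for mesons — `stub_meson_reflect`, p143225), Θ-covariant BY CONSTRUCTION
  (`torusTheta_insertionSym`), local w.r.t. the positive links at lattice times `2 ≤ t ≤ L_k − 1`
  (`stub_insertion_local`, p143638).
The canonical distributions of this functional are `qcdLatticeDistSymAP` (Defs append, pending review); the package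
`SymThermalLatticePackage` asks of them P1, P2 (k-uniform E0′ bound on `⁰𝒮`), P3′ (convergence on
off-diagonal real tensors), P6 (asymptotic translations), P9 (k-uniform spatial clustering), P10′ (`ClustersCS` of the
thermal symmetrised `n`-point functions + the statement's `HasLatticeMassGap`), P11 (non-vanishing witnesses), and ONE
comparison clause P12′ tying it to the statement: `qcdLatticeDistSymAP sch k n σ (⊗fᵢ) − qcdLatticeSchwinger sch k n σ f → 0`
on off-diagonal real tensors (boundary condition + density symmetrisation are invisible in the continuum limit of a gapped
theory — the content of the twisted-trace line's `SchwingerReturn`, now at the scheme).  NO positivity clause, NO permutation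
clause, NO normalisation / hermiticity / tensor-agreement clause: those are theorems or registered stubs:
* `stub_permExactSymAP` (wave 3; exact E3 of the symmetrised thermal distributions — insertions are central);
* `stub_symAP_osForm_eq_pairing` (wave 3): the OS form `Σᵢⱼ Λ(ΘGᵢ* ⊗ Gⱼ)` of the thermal symmetrised distributions IS the
  thermal pairing `⟨X · ΘX⟩_AP` of the smeared observable `symSmearedObs` (when `Z_AP ≠ 0`);
* `stub_symAP_pairing_nonneg` (wave 3): that pairing is `≥ 0` with vanishing imaginary part when the `Gⱼ` live at lattice
  times `2 ≤ t ≤ L_k − 1` (`stub_abstractThermalRP` + `stub_insertion_local`);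
* `stub_rpOfSymThermal` (the lead's): EVENTUAL APPROXIMATE positivity of the OS forms of `qcdLatticeDistSymAP` for every
  finite time-ordered family — from the two previous stubs by compact cutoffs inside the supports
  (`exists_offDiagonal_cutoff_tendsto'`), joint continuity of `appendTensor` / `osAdjoint`, and the package's own E0′ bound P2.
The composition is the soft OS closure VI `qcdOf_of_asymptoticPackage` (asymptotic agreement P0′, `ClustersCS` of `Λ`; file
`…SoftClosureAsymptotic.lean`) applied with `Λ k := qcdLatticeDistSymAP sch k`.

All support files and all provable stubs are LANDED and imported; the remaining registered stubs are exactly the two open problems: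
`stub_symThermalLatticeQCD` (THE construction) and `stub_rotation` (E1, = item 8840).  The r3d skeleton (package on the
periodic functional with P8 assumed; closure V `qcdOf_of_latticePackage`) stays valid and is kept as `Lines/SketchR3d.lean`.

Disproof used: none exists for this crux (`ledger crux ls`: no Disproof.lean).
-/

noncomputable section

open Filter Topology ComplexConjugate MeasureTheory
open scoped SchwartzMap InnerProductSpace ComplexOrder BigOperators
open Literature.MathematicalPhysics.AQFT Literature.MathematicalPhysics.QuantumLattice
open Literature.MathematicalPhysics.QuantumLattice.GrassmannAlgebra
open Literature.MathematicalPhysics.QuantumFieldTheory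
open Literature.Probability.LatticeModels (box Site)
open Summit.QuantumFields.QCD.Theses.QuarksAsStableAction (UnquenchedChessboardBound WilsonQuarkStability
  StableActionBridge StableActionBridgeOfSplit ChiralCompletion ThresholdQCD)

namespace Summit.QuantumFields.QCD.Cruxes.StableActionBridge.Sketch

variable {Nf : ℕ}

local notation "E4" => EuclideanSpace ℝ (Fin 4)
local notation "𝔾" => Matrix.specialUnitaryGroup (Fin 3) ℂ

/-! ## Landed stubs of r3e (imported; formerly `sorry` stubs of this skeleton)

* `stub_permExactSymAP` — `Theorems/…StubPermExactSymAP.lean` (p146107): exact E3 of `qcdLatticeDistSymAP`.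
* `stub_symAP_osForm_eq_pairing` — `Theorems/…StubSymAPOsFormEqPairing.lean` (p146619): the OS form IS `⟨X · ΘX⟩_AP` of `symSmearedObs`.
* `stub_symAP_pairing_nonneg` — `Theorems/…StubSymAPPairingNonneg.lean` (p146073): that pairing is `≥ 0`, `im = 0` in the lattice-time window.
* `stub_rpOfSymThermal` — `Theorems/…StubRpOfSymThermal.lean` (the lead's, p147581; P8 as a theorem: eventual approximate OS positivity of
  `qcdLatticeDistSymAP` for every finite time-ordered family, by compact cutoffs + P2).
* wave 2: `stub_abstractThermalRP` (p143920), `stub_insertion_local` (p143638), `stub_meson_reflect` (p143225); wave 1: `stub_permExact`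
  (p141413), `stub_offDiagonalTensorDensity` (p141569); closures I–VI and the Defs file (+ its Θ-symmetrised append p144972). -/

/-! ## Proved glue -/

/-- E0-normalisation of the symmetrised thermal distributions, exactly at every `k` (degree `0` is point evaluation). -/
theorem isNormalized_qcdLatticeDistSymAP {Nf : ℕ} (sch : QCDScheme Nf) (k : ℕ) :
    LabelledSchwingerFamily.IsNormalized (qcdLatticeDistSymAP sch k) :=
  fun σ F => (qcdLatticeDistSymAP_zero_apply sch k σ F).trans (congrArg F (Subsingleton.elim _ _))

/-- **P3 for the symmetrised thermal distributions from P2 + P3′ + totality** (twin of `tendsto_qcdLatticeDist_of_tensor`):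
convergence on off-diagonal real tensors and the k-uniform E0′ bound give convergence on all of `⁰𝒮` by
`tendsto_offDiagonal_of_tensor` and `stub_offDiagonalTensorDensity`. -/
theorem tendsto_qcdLatticeDistSymAP_of_tensor {Nf : ℕ} (sch : QCDScheme Nf) {s : ℕ} {α β : ℝ}
    (hbound : ∀ (n : ℕ) (σ : Fin n → QCDField Nf), ∀ᶠ k in atTop, ∀ F : 𝓢((Fin n → E4), ℂ), IsOffDiagonal F →
      ‖qcdLatticeDistSymAP sch k n σ F‖ ≤ α * (n.factorial : ℝ) ^ β * schwartzNorm (n * s) F)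
    (hconv : ∀ n : ℕ, n ≠ 0 → ∀ (σ : Fin n → QCDField Nf) (f : Fin n → 𝓢(E4, ℝ)) (F : 𝓢((Fin n → E4), ℂ)),
      IsTensorOf F (fun i => ofRealTest (f i)) → IsOffDiagonal F →
      ∃ c : ℂ, Tendsto (fun k => qcdLatticeDistSymAP sch k n σ F) atTop (𝓝 c)) :
    ∀ (n : ℕ) (σ : Fin n → QCDField Nf) (F : 𝓢((Fin n → E4), ℂ)), IsOffDiagonal F →
      ∃ c : ℂ, Tendsto (fun k => qcdLatticeDistSymAP sch k n σ F) atTop (𝓝 c) := by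
  intro n σ F hF
  rcases Nat.eq_zero_or_pos n with rfl | hn
  · exact ⟨F default, by simpa only [qcdLatticeDistSymAP_zero_apply] using tendsto_const_nhds⟩
  · refine tendsto_offDiagonal_of_tensor (fun k => qcdLatticeDistSymAP sch k n σ) (hbound n σ)
      (stub_offDiagonalTensorDensity n) ?_ F hF
    rintro G ⟨f, hGf⟩ hGo
    exact hconv n hn.ne' σ f G hGf hGo

/-! ## The two honest pieces of the reshaped line -/

/-- **The lattice-side package of `N_f`-flavour Wilson lattice QCD, read on the THERMAL Θ-SYMMETRISED functional** (the
statement of `stub_symThermalLatticeQCD`; open problem; r3e).  ONE mass-independent regularisation `reg` (spacings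
`a_k → 0`, two-loop couplings, volumes, flavour-blind `m_crit(k)`, `Z_m(k)`) with leading-log `HasMassScaling` and
`IsChiralAtZero`, such that for EVERY positive renormalised mass tuple `m` there are species renormalisations `z, shift` such
that, for the scheme `sch = reg.scheme m z shift` and the canonical thermal symmetrised distributions `Λₖ = qcdLatticeDistSymAP sch k`:
(P1) two-loop asymptotic scaling and bare masses eventually on the physical branch `m_f(k) > −1` (exactly the clauses of `IsQCDAlong`;
`β_k ≥ 0` eventually, needed for reflection positivity, FOLLOWS for `N_f ≤ 16`: `QCDScheme.eventually_le_beta_of_hasAsymptoticScaling`);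
(P2) a k-uniform E0′ bound `‖Λₖ(σ, F)‖ ≤ α (n!)^β |F|_{ns}` on `⁰𝒮`;
(P3′) convergence of `Λₖ(σ, ⊗fᵢ)` along the full sequence on every off-diagonal real tensor, `n ≥ 1`;
(P6) asymptotic invariance under every translation of `ℝ⁴` on `⁰𝒮`;
(P9) k-uniform SPATIAL clustering of the truncated functions of time-ordered tensors (E4, no rate);
(P10′) ONE rate `Δ > 0` with Cauchy–Schwarz clustering `ClustersCS 4 (qcdLatticeSchwingerSymAP sch) Δ` of the thermal
symmetrised `n`-point functions (Lüscher's positive transfer matrix with a gap delivers exactly this on the RP family) AND the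
statement's uniform lattice gap `sch.HasLatticeMassGap Δ`;
(P11) eventual lower bounds `ε > 0` for the glue and flavour-changing-pseudoscalar truncated two-point functions and the glue
`κ₃` of `Λₖ` (non-triviality, dynamical quarks, non-Gaussianity);
(P12′) the COMPARISON with the statement's functional: `Λₖ(σ, ⊗fᵢ) − qcdLatticeSchwinger sch k n σ f → 0` on off-diagonal real
tensors, `n ≥ 1` (time-periodic vs antiperiodic quarks and forward vs time-symmetrised action density agree in the continuum
limit of a gapped theory — the scheme-level content of `SchwingerReturn` of line `twisted_trace_transfer`).
Normalisation, hermiticity, permutation symmetry and REFLECTION POSITIVITY are theorems / registered stubs, not clauses.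
[difficulty: open-problem] -/
def SymThermalLatticePackage (Nf : ℕ) : Prop :=
  ∃ reg : QCDRegularisation Nf, reg.HasMassScaling ∧ reg.IsChiralAtZero ∧
      ∀ m : Fin Nf → ℝ, (∀ f, 0 < m f) → ∃ (z shift : QCDField Nf → ℕ → ℝ),
        (reg.scheme m z shift).HasAsymptoticScaling ∧
        (∀ fl : Fin Nf, ∀ᶠ k in atTop, -1 < (reg.scheme m z shift).mq fl k) ∧
        (∃ (s : ℕ) (α β : ℝ), 0 ≤ α ∧ ∀ (n : ℕ) (σ : Fin n → QCDField Nf), ∀ᶠ k in atTop,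
          ∀ F : 𝓢((Fin n → E4), ℂ), IsOffDiagonal F →
            ‖qcdLatticeDistSymAP (reg.scheme m z shift) k n σ F‖ ≤ α * (n.factorial : ℝ) ^ β * schwartzNorm (n * s) F) ∧
        (∀ n : ℕ, n ≠ 0 → ∀ (σ : Fin n → QCDField Nf) (f : Fin n → 𝓢(E4, ℝ)) (F : 𝓢((Fin n → E4), ℂ)),
          IsTensorOf F (fun i => ofRealTest (f i)) → IsOffDiagonal F →
          ∃ c : ℂ, Tendsto (fun k => qcdLatticeDistSymAP (reg.scheme m z shift) k n σ F) atTop (𝓝 c)) ∧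
        (∀ (n : ℕ) (σ : Fin n → QCDField Nf) (a : E4) (F : 𝓢((Fin n → E4), ℂ)), IsOffDiagonal F →
          Tendsto (fun k => qcdLatticeDistSymAP (reg.scheme m z shift) k n σ (translateMulti a F) -
            qcdLatticeDistSymAP (reg.scheme m z shift) k n σ F) atTop (𝓝 0)) ∧
        (∀ (n n' : ℕ) (σ : Fin n → QCDField Nf) (σ' : Fin n' → QCDField Nf) (F : 𝓢((Fin n → E4), ℂ))
          (G : 𝓢((Fin n' → E4), ℂ)), IsTimeOrdered F → IsTimeOrdered G → ∀ a : E4, a 0 = 0 → a ≠ 0 →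
          ∀ ε : ℝ, 0 < ε → ∃ t₀ : ℝ, ∀ t : ℝ, t₀ ≤ t → ∀ H : 𝓢((Fin (n + n') → E4), ℂ),
            IsAppendTensorOf H (osAdjoint F) (translateMulti (t • a) G) →
            ∀ᶠ k in atTop, ‖qcdLatticeDistSymAP (reg.scheme m z shift) k (n + n') (Fin.append (σ ∘ Fin.rev) σ') H -
              qcdLatticeDistSymAP (reg.scheme m z shift) k n (σ ∘ Fin.rev) (osAdjoint F) *
                qcdLatticeDistSymAP (reg.scheme m z shift) k n' σ' G‖ ≤ ε) ∧
        (∃ Δ : ℝ, 0 < Δ ∧ ClustersCS 4 (qcdLatticeSchwingerSymAP (reg.scheme m z shift)) Δ ∧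
          (reg.scheme m z shift).HasLatticeMassGap Δ) ∧
        (∃ (F G : 𝓢((Fin 1 → E4), ℂ)) (H : 𝓢((Fin (1 + 1) → E4), ℂ)),
          IsTimeOrdered F ∧ IsTimeOrdered G ∧ IsAppendTensorOf H (osAdjoint F) G ∧ ∃ ε : ℝ, 0 < ε ∧
            ∀ᶠ k in atTop, ε ≤ ‖qcdLatticeDistSymAP (reg.scheme m z shift) k (1 + 1) (fun _ => QCDField.glue) H -
              qcdLatticeDistSymAP (reg.scheme m z shift) k 1 (fun _ => QCDField.glue) (osAdjoint F) *
                qcdLatticeDistSymAP (reg.scheme m z shift) k 1 (fun _ => QCDField.glue) G‖) ∧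
        (∀ f g : Fin Nf, f ≠ g → ∃ (F G : 𝓢((Fin 1 → E4), ℂ)) (H : 𝓢((Fin (1 + 1) → E4), ℂ)),
          IsTimeOrdered F ∧ IsTimeOrdered G ∧ IsAppendTensorOf H (osAdjoint F) G ∧ ∃ ε : ℝ, 0 < ε ∧
            ∀ᶠ k in atTop, ε ≤ ‖qcdLatticeDistSymAP (reg.scheme m z shift) k (1 + 1) (fun _ => QCDField.pseudoRe f g) H -
              qcdLatticeDistSymAP (reg.scheme m z shift) k 1 (fun _ => QCDField.pseudoRe f g) (osAdjoint F) *
                qcdLatticeDistSymAP (reg.scheme m z shift) k 1 (fun _ => QCDField.pseudoRe f g) G‖) ∧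
        (∃ (f g h : 𝓢(E4, ℂ)) (Ffgh : 𝓢((Fin 3 → E4), ℂ)) (Fgh Ffh Ffg : 𝓢((Fin 2 → E4), ℂ))
          (Ff Fg Fh : 𝓢((Fin 1 → E4), ℂ)),
          IsTensorOf Ffgh ![f, g, h] ∧ IsOffDiagonal Ffgh ∧ IsTensorOf Fgh ![g, h] ∧ IsTensorOf Ffh ![f, h] ∧
          IsTensorOf Ffg ![f, g] ∧ IsOffDiagonal Fgh ∧ IsOffDiagonal Ffh ∧ IsOffDiagonal Ffg ∧
          IsTensorOf Ff ![f] ∧ IsTensorOf Fg ![g] ∧ IsTensorOf Fh ![h] ∧ ∃ ε : ℝ, 0 < ε ∧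
            ∀ᶠ k in atTop, ε ≤ ‖qcdLatticeDistSymAP (reg.scheme m z shift) k 3 (fun _ => QCDField.glue) Ffgh
              - qcdLatticeDistSymAP (reg.scheme m z shift) k 1 (fun _ => QCDField.glue) Ff *
                  qcdLatticeDistSymAP (reg.scheme m z shift) k 2 (fun _ => QCDField.glue) Fgh
              - qcdLatticeDistSymAP (reg.scheme m z shift) k 1 (fun _ => QCDField.glue) Fg *
                  qcdLatticeDistSymAP (reg.scheme m z shift) k 2 (fun _ => QCDField.glue) Ffh
              - qcdLatticeDistSymAP (reg.scheme m z shift) k 1 (fun _ => QCDField.glue) Fh *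
                  qcdLatticeDistSymAP (reg.scheme m z shift) k 2 (fun _ => QCDField.glue) Ffg
              + 2 * (qcdLatticeDistSymAP (reg.scheme m z shift) k 1 (fun _ => QCDField.glue) Ff *
                  qcdLatticeDistSymAP (reg.scheme m z shift) k 1 (fun _ => QCDField.glue) Fg *
                  qcdLatticeDistSymAP (reg.scheme m z shift) k 1 (fun _ => QCDField.glue) Fh)‖) ∧
        (∀ n : ℕ, n ≠ 0 → ∀ (σ : Fin n → QCDField Nf) (f : Fin n → 𝓢(E4, ℝ)) (F : 𝓢((Fin n → E4), ℂ)),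
          IsTensorOf F (fun i => ofRealTest (f i)) → IsOffDiagonal F →
          Tendsto (fun k => qcdLatticeDistSymAP (reg.scheme m z shift) k n σ F -
            qcdLatticeSchwinger (reg.scheme m z shift) k n σ f) atTop (𝓝 0))

/-- **The E1 (rotation) module for `N_f` flavours** (the statement of `stub_rotation`; open problem — there is no
non-perturbative `O(4)`-restoration theorem in `d = 4`): for every lattice-QCD scheme with two-loop asymptotic scaling, bare
masses eventually on the physical branch and a uniform lattice gap, every labelled Schwinger family that is the `k → ∞` limit of
the honest lattice `n`-point functions on off-diagonal real tensors is invariant under proper rotations on `⁰𝒮`.  This is item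
stmt-QuantumFields-8840 `RotationRestoration` (FourMirrorsWardE1 / DiagonalSpine / GapBuysCauchyRate) at the flavour number `Nf`;
the line uses it only at `N_f ∈ {2, 3}`. [difficulty: open-problem] -/
def RotationModule (Nf : ℕ) : Prop :=
  ∀ sch : QCDScheme Nf, sch.HasAsymptoticScaling →
      (∀ fl : Fin Nf, ∀ᶠ k in atTop, -1 < sch.mq fl k) → (∃ Δ : ℝ, 0 < Δ ∧ sch.HasLatticeMassGap Δ) →
      ∀ S : LabelledSchwingerFamily (QCDField Nf) E4,
        (∀ n : ℕ, n ≠ 0 → ∀ (σ : Fin n → QCDField Nf) (f : Fin n → 𝓢(E4, ℝ)) (F : 𝓢((Fin n → E4), ℂ)),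
          IsTensorOf F (fun i => ofRealTest (f i)) → IsOffDiagonal F →
          Tendsto (fun k => qcdLatticeSchwinger sch k n σ f) atTop (𝓝 (S n σ F))) →
        ∀ (n : ℕ) (σ : Fin n → QCDField Nf) (R : E4 ≃ₗᵢ[ℝ] E4),
          LinearMap.det (R.toLinearEquiv : E4 →ₗ[ℝ] E4) = 1 →
          ∀ F : 𝓢((Fin n → E4), ℂ), IsOffDiagonal F → S n σ (linActMulti R F) = S n σ F


/-- **Stub (open, the lead's): the thermal symmetrised lattice-side package for `N_f = 2` and `N_f = 3`.** -/
theorem stub_symThermalLatticeQCD : ∀ Nf : ℕ, Nf = 2 ∨ Nf = 3 → SymThermalLatticePackage Nf := by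
  sorry

/-- **Stub (open): the E1 module for `N_f = 2` and `N_f = 3`.**  See `RotationModule`; implied by item 8840. -/
theorem stub_rotation : ∀ Nf : ℕ, Nf = 2 ∨ Nf = 3 → RotationModule Nf := by
  sorry

/-! ## Dockings (proved) -/

/-- Item 8840 `RotationRestoration` (rendered in three route files with the same text, quantified over ALL `Nf`) gives the
rotation module at every `Nf`; recorded as the statement-level implication so that a closure of 8840 by name feeds
`stub_rotation` (`fun h Nf _ => h Nf`). [folklore] -/
theorem rotationModule_of_all (h : ∀ Nf : ℕ, RotationModule Nf) : ∀ Nf : ℕ, Nf = 2 ∨ Nf = 3 → RotationModule Nf :=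
  fun Nf _ => h Nf

/-- **The crux is literally the conjunct**: both hypotheses of the bridge are theorems of the tree (A = item 9735,
`UnquenchedChessboardBound_of`; S = item 9736, `WilsonQuarkStability_of`), so `StableActionBridge ↔ QCD`. [folklore] -/
theorem stableActionBridge_iff_qcd : StableActionBridge ↔ _root_.QCD :=
  ⟨fun h => h Summit.QuantumFields.QCD.Theorems.UnquenchedChessboardBoundLine.UnquenchedChessboardBound_of
      Summit.QuantumFields.QCD.Cruxes.WilsonQuarkStability.FreeTangentLandauChessboard.WilsonQuarkStability_of,
    fun h _ _ => h⟩

/-- The cycle-8 item split is lossless and stays available: `StableActionBridge ↔ (ThresholdQCD ∧ ChiralCompletion)`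
(items 8794 ∧ 17394; glue p131993).  Kept so that a closure of those items still closes the crux. [folklore] -/
theorem crux_iff_items : StableActionBridge ↔ (ThresholdQCD ∧ ChiralCompletion) := by
  refine ⟨fun h => ⟨?_, ?_⟩, fun h _ _ => ⟨h.2 2 (Or.inl rfl) (h.1 2 (Or.inl rfl)), h.2 3 (Or.inr rfl) (h.1 3 (Or.inr rfl))⟩⟩
  · have hq : _root_.QCD := stableActionBridge_iff_qcd.1 h
    intro Nf hNf
    rcases hNf with rfl | rfl
    · obtain ⟨reg, hMS, -, hall⟩ := hq.1
      exact ⟨0, le_rfl, reg, hMS, hall⟩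
    · obtain ⟨reg, hMS, -, hall⟩ := hq.2
      exact ⟨0, le_rfl, reg, hMS, hall⟩
  · have hq : _root_.QCD := stableActionBridge_iff_qcd.1 h
    intro Nf hNf _
    rcases hNf with rfl | rfl
    · exact hq.1
    · exact hq.2


/-! ## The composition -/

/-- `QCDOf N_f` for `N_f ∈ {2,3}` from the stubs: the r3e package, expanded to the hypotheses of the asymptotic closure
`qcdOf_of_asymptoticPackage` with `Λ k := qcdLatticeDistSymAP sch k` — P0′ = P12′; P3 by `tendsto_qcdLatticeDistSymAP_of_tensor`;
P4 exact (`isNormalized_qcdLatticeDistSymAP`); P7 identically by `stub_permExactSymAP`; P8 = `stub_rpOfSymThermal` (with `β_k ≥ 0`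
eventually from asymptotic scaling, `N_f ≤ 16`); P10′ is the
package's `ClustersCS` (definitionally, `qcdLatticeSchwingerSymAP`); the rotation module is `stub_rotation`. -/
theorem qcdOf_of_stubs (Nf : ℕ) (hNf : Nf = 2 ∨ Nf = 3) : QCDOf Nf := by
  obtain ⟨reg, hms, hχ, hall⟩ := stub_symThermalLatticeQCD Nf hNf
  refine qcdOf_of_asymptoticPackage ⟨reg, hms, hχ, fun m hm => ?_⟩ (stub_rotation Nf hNf)
  obtain ⟨z, shift, hAS, hbr, ⟨s, α, β, hα, hb⟩, hconv, htrans, hcl, ⟨Δ, hΔ, hCS, hgap⟩, hglue, hpseudo, hκ₃,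
    hcmp⟩ := hall m hm
  have hNf16 : Nf ≤ 16 := by rcases hNf with rfl | rfl <;> norm_num
  have hβ : ∀ᶠ k in atTop, 0 ≤ (reg.scheme m z shift).β k :=
    QCDScheme.eventually_le_beta_of_hasAsymptoticScaling hNf16 (reg.scheme m z shift) hAS 0
  refine ⟨z, shift, fun k => qcdLatticeDistSymAP (reg.scheme m z shift) k, hcmp, hAS, hbr, ⟨s, α, β, hα, hb⟩, ?_, ?_,
    htrans, ?_, ?_, hcl, ⟨Δ, hΔ, ?_, hgap⟩, hglue, hpseudo, hκ₃⟩
  · exact tendsto_qcdLatticeDistSymAP_of_tensor (reg.scheme m z shift) hb hconv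
  · exact Eventually.of_forall fun k => isNormalized_qcdLatticeDistSymAP (reg.scheme m z shift) k
  · intro n σ π F _
    have h0 : (fun k => qcdLatticeDistSymAP (reg.scheme m z shift) k n σ (permTest π F) -
        qcdLatticeDistSymAP (reg.scheme m z shift) k n (σ ∘ π) F) = fun _ => 0 :=
      funext fun k => by rw [stub_permExactSymAP, sub_self]
    rw [h0]
    exact tendsto_const_nhds
  · exact stub_rpOfSymThermal (reg.scheme m z shift) hβ hbr hb
  · exact hCS

/-- **The composition**: the registered stubs imply the crux `QuarksAsStableAction.StableActionBridge`, concluded BY NAME: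
the bridge hypotheses A, S are discarded (they are theorems) and `QCD = QCDOf 2 ∧ QCDOf 3` is the proved soft OS closure of the
thermal symmetrised lattice package and the rotation module at `N_f = 2, 3`. -/
theorem StableActionBridge_of : StableActionBridge :=
  fun _ _ => ⟨qcdOf_of_stubs 2 (Or.inl rfl), qcdOf_of_stubs 3 (Or.inr rfl)⟩

end Summit.QuantumFields.QCD.Cruxes.StableActionBridge.Sketch

end
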